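import Summits.QuantumFields.YangMills.Theorems.BalabanUVNodesK0FlatHBBound164P
import Summits.QuantumFields.YangMills.Theorems.BalabanUVNodesK0FlatPortBodyP
import Summits.QuantumFields.YangMills.Theorems.BalabanUVNodesK0Stub1Letter165GtLetterAtRecord
import Summits.QuantumFields.YangMills.Theorems.UnitScaleTiltProp8HalvingMultiplierLetter
import HarnessLib

/-!
# K0⁷ STUB 1 (`stub_prop8StepCoP13`), sub-target S4 — **THE MULTIPLIER LETTER `𝔐 = Q*(QGQ*)⁻¹QG` AT NODE 00's CARRIER**: [15] p. 298 «the right-hand side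
# of (133) can be estimated by O(1)C₁B₃ε₁(Lʲη)⁻³» — the operator `1 − P₀ᵀ = Q*(QGQ*)⁻¹QG` ((131), (133)) is bounded on the `(−3)`-weighted sup norms AT THE
# FLAT BACKGROUND ON THE TOP LAYER of a nested family `D : Domains P`, typed ONCE over `(P : Params) (k : ℕ)` in k0-s1-w3's `K0FlatCubeOpsTextP` currency and
# instanced at the record's tori `F.P K` — the generic-`P` ∕ T⁴ port of the ym3-torus cell's `HalvingMultiplierLetter` §3 (`multiplierLetter_real ∕ _matrix`,
# stated there at the T³ carrier only)

Cell `pub-ymgap`, width seat `pub-ymgap-k0-s1-w4` g0 (director-ym R399 (3a) ∕ №207; CLAIM-1 ∕ INTENT-1 on the cell bus).  `--kind proof --supports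
stmt-QuantumFields-20541 --as helper`; count-neutral.  [15] = [Balaban1985Variational] (CMP **102** (1985) 277–309); [B6] = [Balaban1984PropagatorsII]
(CMP **96** (1984) 223–250).

WHY.  For the tangent component `A₁ = −G̃w` of the Sect. F heart ((158), `w = (δ∕δA′)V(A₁ + HB)`), the THIRD letter of (165) — `|∂^{η*}∂^ηA₁|`, the one the (168)
step consumes (`Letters10On`) — is read off the EQUATION on the gauge slice (153) `R∂*A₁ = 0`: `∂*∂A₁ = Δ_aA₁ = −w + Q*(QGQ*)⁻¹QG·w` (print (131)–(133); kernel-checked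
model-generically by the ym3-torus cell, `HalvingELJunction`, and the road of dag-n07-w8's N07 piece 4 ∕ k0-s1-w1 g4's junction, both of which DISPLAY the row
`|Q*(QGQ*)⁻¹QG·w| ≤ β₂` resp. `hM`).  THIS FILE supplies that row.  By `HalvingMultiplierLetter.QsE_EE_QE_GE_eq_of_weights` (model-generic, [B6] p. 228
«the only assumption … was the positivity of Δ_a»), for ANY auxiliary weights `a`:  `𝔐f = ∂*∂H(QG_af) + Q*(a·QG_af)`; the first term is the text's `∂*∂`-row of `H`
((161)₁ row 3 + (162), k0-s1-w3's P-generic `K0FlatHBBound164P.rows164_of_hDecayLetterD`) on the datum `(L^{j(c)}η)|X(c)| ≤ C_Q·C_G·β`, `X = QG_af` (a `G_a`-sup row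
∘ the contraction row of `Q`); the second is the TRANSPOSE of the top-level block average (`HalvingMultiplierLetter.abs_QsE_apply_le_of_top`, model-generic: at a fine bond of
the top region only top-level index bonds see it, total weight `(Lᵏ)^{−d}`) against the band-weighted datum `|a(c)X(c)| ≤ (Lᵏ)^d·C_QC_Gβ`.

WHAT IS PROVED (sorry-free; no definition; axioms standard).
* §1 `pow_sub_eq_inv` (`L^{k−j} = (Lʲ(L⁻¹)ᵏ)⁻¹`) · `rowsSup_real` — the four left-weighted rows of a pinned `H` on SUP-sized data `|X(c)| ≤ t·L^{k−j(c)}` from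
  `HDecayLetterD` ∧ `RowSum162` (P-generic twin of UST `HalvingHMatrixSup.rowsSup_real`).
* §2 ★★ `multiplierLetter_real` — generic `(P, k, D)`: INPUTS `IsFlatH P k D H` + `HDecayLetterD P k D dBI w H B₀ δ₀` + `RowSum162 P k D dBI w δ₀ B₃` (`dBI ≥ 0`,
  `0 ≤ δ₀, B₀`), a `G_a`-sup row `IsFlatGW P k D ha G ∧ GtSupLetterG P k w G C_G` at BAND weights `a(c) ≤ (Lᵏ)^{d−1}·L^{j(c)}` (`d = P.d`; = UST's `(Lᵏ)²L^{j}` at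
  d = 3; met by the port's print-natural `(Lᵏ∕Lʲ)²(Lʲ)^d` since `j ≤ k`), `QContrLetter P k D w C_Q`; OUTPUT: for `w₃|f| ≤ β` and a bond `b` with `w₁(b) = w₃(b) = 1` whose
  source lies in the top region `Ω_k`: `|𝔐f(b)| ≤ (B₀B₃ + 1)·C_Q·C_G·β`, `𝔐f b := QsE D (EE D (QE D (GE D (toLp 2 f)))) b` at units `c = Lᵏ`, auxiliary weights `a ≡ 1`
  (= print's `Q*(QGQ*)⁻¹QG`, canonical in `a`) · ★ `multiplierLetter_matrix` — the same for `M_N(ℂ)`-valued currents through the kernel extension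
  `ℳ b = Σ_{b′}(𝔐e_{b′})(b)·f(b′)` (k0-s1-w1's `reFunctional_kernel` + `norm_le_of_forall_reFunctional`; every `N`, no component loss) · `multiplierLetter_window` —
  under the (152) level weights `IsLevWeight P k D w` (`D.k = k`) the two weight hypotheses are automatic on every window `Y ⊆ Ω_k` (dag-n07-w8's `β₂` slot shape
  `w 3 b * |𝔐f b| ≤ …` at `b.src ∈ Y`).
* §3 `multiplierLetter_real_of_bodyAt` ∕ ★★ `multiplierLetter_matrix_of_bodyAt_adm22` — the editions in which the `H`-rows are READ OFF k0-s1-w3's `BodyAt P k D w B₀ δ₀ B₃`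
  (its `IsFlatH`-pinned `H`, `dBI ≥ distBI ≥ 0`, (162), (161)₁) and the `Q`-row is `K0FlatPortBodyP.qContrLetter_of_adm22` (`Adm22 D R M`, `2L ≤ R·M`, `C_Q = L`); and
  ★★★ `exists_multiplierLetter_of_adm22_T4` — at EVERY admissible family of the record's tori (P9 `body_of_adm22_T4`): the multiplier letter for matrix currents with
  constant `(B₀B₃ + 1)·L·C_G·β`, the `G_a` band sup row the ONLY displayed input.
HONEST SCOPE.  Triangle-inequality bookkeeping over ported [B6] rows and two model-generic UST identities; the `G_a` band row is DISPLAYED (supplier: k0-s1-w3's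
`K0FlatPortKernelRowsP` assembly at its l.260 weights `(Lᵏ∕Lʲ)²(Lʲ)^{d}` — exported there behind `∃`, a band-exposed re-export is the open supplier); FLAT background,
TOP LAYER only (where the (165)-`A₁` clause lives); nothing of Bałaban's analysis asserted beyond the cited kernel theorems; `stub_prop8StepCoP13` ∕ K0⁷ NOT closed;
N07 NOT discharged; counts unmoved (28∕28 · 5∕27); one finite 𝕋⁴ programme at fixed ε — R4 closes the conditional finite-𝕋⁴ rung `BalabanLadder.UV` only, never the
summit; the YM mass gap (Clay) is NOT proved by any of this; nothing continuum ∕ ℝ⁴ ∕ OS.  No `sorry`, no `def`, no `instance`, no `notation`.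

References: [15] (131)–(133) p.298, (137) p.298, (152) p.301, (158) p.302, (161)–(162) p.303, (165) p.304; [B6] (2.16) p.225, (2.19)–(2.22) p.226, (2.35) p.228,
Cor. 2.8 (2.150)–(2.151) p.249; [Balaban1984PropagatorsI] (1.11) p.19, (1.18) p.20.
-/

set_option autoImplicit false

noncomputable section

open scoped BigOperators InnerProductSpace Matrix.Norms.L2Operator

namespace Summit.QuantumFields.YangMills.Theorems.K0Stub1MultiplierLetterP

open Literature.MathematicalPhysics.QuantumFieldTheory.Balaban1983to89
open Literature.MathematicalPhysics.QuantumFieldTheory.Balaban1983to89.T4Continuum (T4Family)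
open B6SectADomainsV1 (Domains)
open B6SectAOperatorsV1 (BondIdx BondIdxSpace QE QsE dcE dcsE aE aE_apply)
open B6SectAVectorModelV1 (GE EE)
open B6SectA (hOp)
open Summit.QuantumFields.YangMills.Theorems.FlatCubeOpsText (Adm22 distBI)
open Summit.QuantumFields.YangMills.Theorems.FlatOpsLettersAssembly (Qfun)
open Summit.QuantumFields.YangMills.Theorems.K0FlatCubeOpsTextP (IsLevWeight IsFlatH flatH IsFlatGW HSupLetterG HDecayLetterD RowSum162 GtSupLetterG QContrLetter
  BodyAt levWeight_nonneg)
open Summit.QuantumFields.YangMills.Theorems.K0FlatHBBound164P (rows164_of_hDecayLetterD)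
open Summit.QuantumFields.YangMills.Theorems.K0FlatPortBodyP (qContrLetter_of_adm22 body_of_adm22_T4)
open Summit.QuantumFields.YangMills.Theorems.K0Stub1Letter165GtLetterAtRecord (reFunctional_kernel)
open Summit.QuantumFields.YangMills.Theorems.HalvingQuarterMatrix (norm_le_of_forall_reFunctional)
open Summit.QuantumFields.YangMills.Theorems.HalvingQuarterCubeSeq (distBI_nonneg)
open Summit.QuantumFields.YangMills.Theorems.FlatCubeLevels (levOf_inOm_eq_top_iff)
open Summit.QuantumFields.YangMills.Theorems.HalvingMultiplierLetter (QsE_EE_QE_GE_eq_of_weights abs_QsE_apply_le_of_top)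
open B11Eq115Space (levOf)

variable {N : ℕ}

/-! ## §1  The rows of `H` on sup-sized data, generic carrier -/

section Rows

variable {P : Params} {k : ℕ} {D : Domains P}

/-- `L^{k−j} = (Lʲ·(L⁻¹)ᵏ)⁻¹` for `j ≤ k` (the datum weight of the text's `H`-letters). [folklore] -/
theorem pow_sub_eq_inv (hL : (0 : ℝ) < (P.L : ℝ)) {j : ℕ} (hj : j ≤ k) :
    (P.L : ℝ) ^ (k - j) = ((P.L : ℝ) ^ j * ((P.L : ℝ)⁻¹) ^ k)⁻¹ := by
  rw [inv_pow, mul_inv, inv_inv, pow_sub₀ _ hL.ne' hj, mul_comm]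

/-- **THE FOUR REAL ROWS OF `H` FOR SUP-SIZED DATA** (P-generic twin of UST `HalvingHMatrixSup.rowsSup_real`): `HDecayLetterD` ∧ `RowSum162` over a `dBI` nonnegative at
`b`, `0 ≤ δ₀, B₀, t`, `0 ≤ w₁(b)`, and `|X(c)| ≤ t·L^{k−j(c)}` at every index bond ⟹ the four left-weighted rows at `b` are `≤ B₀B₃t`.
[cite: Balaban1985Variational, (161)-(162) p.303, (165) p.304] -/
theorem rowsSup_real {dBI : PBond P 0 → BondIdx D → ℝ} {w : ℕ → PBond P 0 → ℝ} {H : (BondIdx D → ℝ) →ₗ[ℝ] (PBond P 0 → ℝ)}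
    {δ₀ B₀ B₃ t : ℝ} (hH : HDecayLetterD P k D dBI w H B₀ δ₀) (h162 : RowSum162 P k D dBI w δ₀ B₃) (hδ₀ : 0 ≤ δ₀) (hB₀ : 0 ≤ B₀)
    (ht : 0 ≤ t) {b : PBond P 0} (hd : ∀ c, 0 ≤ dBI b c) (hwb : 0 ≤ w 1 b) {X : BondIdx D → ℝ}
    (hX : ∀ c : BondIdx D, |X c| ≤ t * (P.L : ℝ) ^ (k - (c.1.1 : ℕ))) :
    w 1 b * (w 1 b * |H X b|) ≤ B₀ * B₃ * t ∧
    (∀ ν : Fin P.d, w 1 b * (w 2 b * (P.L : ℝ) ^ k * |H X ⟨b.src.shift ν, b.dir⟩ - H X b|) ≤ B₀ * B₃ * t) ∧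
    w 1 b * (w 3 b * |(dcsE ((P.L : ℝ) ^ k) (dcE ((P.L : ℝ) ^ k) (WithLp.toLp 2 (H X)))) b|) ≤ B₀ * B₃ * t ∧
    w 1 b * (w 3 b * ((P.L : ℝ) ^ k) ^ 2 *
        |∑ ν : Fin P.d, ((H X b - H X ⟨b.src.shift ν, b.dir⟩) + (H X b - H X ⟨b.src.unshift ν, b.dir⟩))|) ≤ B₀ * B₃ * t := by
  -- the effective-datum bound with `β = t`: `e^{−½δ₀d} ≤ 1 ≤ d + 1`
  have hXeff : ∀ c : BondIdx D, Real.exp (-(δ₀ / 2 * dBI b c)) * |X c| ≤ t * ((dBI b c + 1) * (P.L : ℝ) ^ (k - (c.1.1 : ℕ))) := by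
    intro c
    have hexp : Real.exp (-(δ₀ / 2 * dBI b c)) ≤ 1 := by rw [Real.exp_le_one_iff]; nlinarith [hd c]
    have hL0 : (0 : ℝ) ≤ (P.L : ℝ) ^ (k - (c.1.1 : ℕ)) := by positivity
    calc Real.exp (-(δ₀ / 2 * dBI b c)) * |X c| ≤ 1 * |X c| := mul_le_mul_of_nonneg_right hexp (abs_nonneg _)
      _ ≤ t * (1 * (P.L : ℝ) ^ (k - (c.1.1 : ℕ))) := by rw [one_mul, one_mul]; exact hX c
      _ ≤ t * ((dBI b c + 1) * (P.L : ℝ) ^ (k - (c.1.1 : ℕ))) :=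
          mul_le_mul_of_nonneg_left (mul_le_mul_of_nonneg_right (by linarith [hd c]) hL0) ht
  exact rows164_of_hDecayLetterD hH h162 hB₀ ht hwb hXeff

end Rows

/-! ## §2  The multiplier letter, generic carrier `(P, k, D)` -/

section Generic

variable {P : Params} {k : ℕ} {D : Domains P}

/-- ★★ **THE MULTIPLIER LETTER, REAL CURRENTS, GENERIC CARRIER**: at a fine bond `b` of the top region with `w₁(b) = w₃(b) = 1`, for a current with `w₃|f| ≤ β`,
`|𝔐f(b)| ≤ (B₀B₃ + 1)·C_Q·C_G·β`, `𝔐 = Q*(QGQ*)⁻¹QG` at units `c = Lᵏ` and auxiliary weights `a ≡ 1` (canonical in `a`), GIVEN: a pinned `H` (`IsFlatH`) with the text's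
`∂*∂`-row and its (162) row sum (`HDecayLetterD`, `RowSum162` over a nonnegative `dBI`), a `G_a`-sup row `GtSupLetterG` for the genuine propagator at band weights
`a(c) ≤ (Lᵏ)^{d−1}L^{j(c)}`, and the contraction row of `Q`.  Print: the `(−3)`-sup boundedness of `1 − P₀ᵀ`, p. 298 after (133); port of UST
`HalvingMultiplierLetter.multiplierLetter_real` (T³) to `(P, k)`.
[cite: Balaban1985Variational, (131)-(133) p.298, (161)-(162) p.303, (165) p.304; Balaban1984PropagatorsII, (2.16) p.225, (2.35) p.228] -/
theorem multiplierLetter_real (hDk : D.k = k) {dBI : PBond P 0 → BondIdx D → ℝ} {w : ℕ → PBond P 0 → ℝ}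
    {H : (BondIdx D → ℝ) →ₗ[ℝ] (PBond P 0 → ℝ)} (hHf : IsFlatH P k D H)
    {δ₀ B₀ B₃ CG CQ : ℝ} (hH : HDecayLetterD P k D dBI w H B₀ δ₀) (h162 : RowSum162 P k D dBI w δ₀ B₃)
    (hδ₀ : 0 ≤ δ₀) (hB₀ : 0 ≤ B₀) (hd : ∀ b c, 0 ≤ dBI b c)
    {a : BondIdx D → ℝ} (ha : ∀ i, 0 < a i) {G : (PBond P 0 → ℝ) →ₗ[ℝ] (PBond P 0 → ℝ)} (hGW : IsFlatGW P k D ha G)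
    (hGsup : GtSupLetterG P k w G CG) (hband : ∀ c : BondIdx D, a c ≤ ((P.L : ℝ) ^ k) ^ (P.d - 1) * (P.L : ℝ) ^ (c.1.1 : ℕ))
    (hQ : QContrLetter P k D w CQ) (hCG : 0 ≤ CG) (hCQ : 0 ≤ CQ)
    (Mop : (PBond P 0 → ℝ) →ₗ[ℝ] (PBond P 0 → ℝ))
    (hMop : ∀ (f : PBond P 0 → ℝ) (b : PBond P 0),
      Mop f b = QsE D (EE D (c := (P.L : ℝ) ^ k) (pow_ne_zero _ (Nat.cast_ne_zero.2 P.L_pos.ne')) (w := fun _ => (1 : ℝ)) (fun _ => one_pos)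
        (QE D (GE D (c := (P.L : ℝ) ^ k) (pow_ne_zero _ (Nat.cast_ne_zero.2 P.L_pos.ne')) (w := fun _ => (1 : ℝ)) (fun _ => one_pos)
          (WithLp.toLp 2 f)))) b)
    {f : PBond P 0 → ℝ} {β : ℝ} (hβ : 0 ≤ β) (hf : ∀ b, w 3 b * |f b| ≤ β)
    {b : PBond P 0} (hb1 : w 1 b = 1) (hb3 : w 3 b = 1) (hbtop : D.InOm k b.src) :
    |Mop f b| ≤ (B₀ * B₃ + 1) * CQ * CG * β := by
  have hc : ((P.L : ℝ) ^ k) ≠ 0 := pow_ne_zero _ (Nat.cast_ne_zero.2 P.L_pos.ne')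
  have hL0 : (0 : ℝ) < (P.L : ℝ) := Nat.cast_pos.mpr P.L_pos
  set t : ℝ := CQ * CG * β with ht
  have ht0 : 0 ≤ t := by positivity
  -- the multiplier datum `X = Q(G_a f)` and its size
  set X : BondIdx D → ℝ := Qfun D (G f) with hX
  have hGf := (hGsup f β hβ hf).1
  have hQX := hQ (G f) (CG * β) (by positivity) hGf
  have hXt : ∀ c : BondIdx D, |X c| ≤ t * (P.L : ℝ) ^ (k - (c.1.1 : ℕ)) := by
    intro c
    have hj : (c.1.1 : ℕ) ≤ k := by have := Nat.lt_succ_iff.1 c.1.1.isLt; omega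
    have hpos : (0 : ℝ) < (P.L : ℝ) ^ (c.1.1 : ℕ) * ((P.L : ℝ)⁻¹) ^ k := by positivity
    rw [pow_sub_eq_inv hL0 hj, ← div_eq_mul_inv, le_div_iff₀ hpos, mul_comm]
    have h := hQX c
    rw [ht]
    linarith
  -- `G f` is `G_a f`, `X` is `Q(G_a f)`
  have hGf' : WithLp.toLp 2 (G f) = GE D hc ha (WithLp.toLp 2 f) := by
    ext b'
    exact hGW f b'
  have hXE : QE D (GE D hc ha (WithLp.toLp 2 f)) = WithLp.toLp 2 X := by
    rw [← hGf']
    ext c'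
    rfl
  -- `𝔐f = ∂*∂H(X) + Q*(aX)`
  have hdec := QsE_EE_QE_GE_eq_of_weights D hc (fun _ => one_pos) ha (WithLp.toLp 2 f)
  rw [hXE] at hdec
  have hHX : hOp (GE D hc (w := fun _ => (1 : ℝ)) (fun _ => one_pos)) (QsE D) (EE D hc (w := fun _ => (1 : ℝ)) (fun _ => one_pos))
      (WithLp.toLp 2 X) = WithLp.toLp 2 (H X) := by
    ext b'
    exact (hHf X b').symm
  have hMb : Mop f b = dcsE ((P.L : ℝ) ^ k) (dcE ((P.L : ℝ) ^ k) (WithLp.toLp 2 (H X))) b + QsE D (aE D a (WithLp.toLp 2 X)) b := by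
    rw [hMop f b, hdec, hHX, PiLp.add_apply]
  -- term 1: the text's `∂*∂`-row of `H` on the datum `X`
  have h1 := (rowsSup_real hH h162 hδ₀ hB₀ ht0 (hd b) (by rw [hb1]; exact zero_le_one) hXt).2.2.1
  rw [hb1, hb3, one_mul, one_mul] at h1
  -- term 2: the transpose of the top-level average against the band-weighted datum
  have hdpow : ((P.L : ℝ) ^ k) ^ (P.d - 1) * (P.L : ℝ) ^ k = ((P.L : ℝ) ^ k) ^ P.d := by
    rw [← pow_succ, Nat.sub_add_cancel P.hd]
  have hωB : ∀ c : BondIdx D, (c.1.1 : ℕ) = D.k → |aE D a (WithLp.toLp 2 X) c| ≤ ((P.L : ℝ) ^ k) ^ P.d * t := by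
    intro c hck
    rw [aE_apply, abs_mul, abs_of_pos (ha c)]
    have hXc := hXt c
    rw [hck, hDk, Nat.sub_self, pow_zero, mul_one] at hXc
    have hwc := hband c
    rw [hck, hDk] at hwc
    calc a c * |(WithLp.toLp 2 X : BondIdxSpace D) c| ≤ (((P.L : ℝ) ^ k) ^ (P.d - 1) * (P.L : ℝ) ^ k) * t :=
          mul_le_mul hwc hXc (abs_nonneg _) (by positivity)
      _ = ((P.L : ℝ) ^ k) ^ P.d * t := by rw [hdpow]
  have h2 := abs_QsE_apply_le_of_top D (aE D a (WithLp.toLp 2 X)) (b := b) (by rw [hDk]; exact hbtop) (by positivity) hωB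
  rw [hDk] at h2
  have hLk : (0 : ℝ) < ((P.L : ℝ) ^ k) ^ P.d := by positivity
  have h2' : |QsE D (aE D a (WithLp.toLp 2 X)) b| ≤ t := by
    calc |QsE D (aE D a (WithLp.toLp 2 X)) b| ≤ (((P.L : ℝ) ^ k) ^ P.d)⁻¹ * (((P.L : ℝ) ^ k) ^ P.d * t) := h2
      _ = t := by field_simp
  -- assemble
  rw [hMb]
  calc |dcsE ((P.L : ℝ) ^ k) (dcE ((P.L : ℝ) ^ k) (WithLp.toLp 2 (H X))) b + QsE D (aE D a (WithLp.toLp 2 X)) b|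
      ≤ |dcsE ((P.L : ℝ) ^ k) (dcE ((P.L : ℝ) ^ k) (WithLp.toLp 2 (H X))) b| + |QsE D (aE D a (WithLp.toLp 2 X)) b| := abs_add_le _ _
    _ ≤ B₀ * B₃ * t + t := add_le_add h1 h2'
    _ = (B₀ * B₃ + 1) * CQ * CG * β := by rw [ht]; ring

/-- ★ **THE MULTIPLIER LETTER FOR `M_N(ℂ)`-VALUED CURRENTS** (no component loss, every `N`): under the rows of `multiplierLetter_real`, for a matrix current with
`w₃‖f‖ ≤ β` and the kernel extension `ℳ(b) = Σ_{b′} (𝔐e_{b′})(b)·f(b′)`, at a bond `b` of the top region with `w₁(b) = w₃(b) = 1`: `‖ℳ(b)‖ ≤ (B₀B₃ + 1)C_QC_G·β`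
(device: every norm-dominated real reading commutes with the kernel extension, k0-s1-w1's `reFunctional_kernel`, and `‖M‖ = sup_g g(M)`, UST `norm_le_of_forall_reFunctional`).
[cite: Balaban1985Variational, (131)-(133) p.298, (165) p.304] -/
theorem multiplierLetter_matrix [DecidableEq (PBond P 0)] (hDk : D.k = k) {dBI : PBond P 0 → BondIdx D → ℝ} {w : ℕ → PBond P 0 → ℝ}
    {H : (BondIdx D → ℝ) →ₗ[ℝ] (PBond P 0 → ℝ)} (hHf : IsFlatH P k D H)
    {δ₀ B₀ B₃ CG CQ : ℝ} (hH : HDecayLetterD P k D dBI w H B₀ δ₀) (h162 : RowSum162 P k D dBI w δ₀ B₃)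
    (hδ₀ : 0 ≤ δ₀) (hB₀ : 0 ≤ B₀) (hB₃ : 0 ≤ B₃) (hd : ∀ b c, 0 ≤ dBI b c) (hw3 : ∀ b, 0 ≤ w 3 b)
    {a : BondIdx D → ℝ} (ha : ∀ i, 0 < a i) {G : (PBond P 0 → ℝ) →ₗ[ℝ] (PBond P 0 → ℝ)} (hGW : IsFlatGW P k D ha G)
    (hGsup : GtSupLetterG P k w G CG) (hband : ∀ c : BondIdx D, a c ≤ ((P.L : ℝ) ^ k) ^ (P.d - 1) * (P.L : ℝ) ^ (c.1.1 : ℕ))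
    (hQ : QContrLetter P k D w CQ) (hCG : 0 ≤ CG) (hCQ : 0 ≤ CQ)
    (Mop : (PBond P 0 → ℝ) →ₗ[ℝ] (PBond P 0 → ℝ))
    (hMop : ∀ (f : PBond P 0 → ℝ) (b : PBond P 0),
      Mop f b = QsE D (EE D (c := (P.L : ℝ) ^ k) (pow_ne_zero _ (Nat.cast_ne_zero.2 P.L_pos.ne')) (w := fun _ => (1 : ℝ)) (fun _ => one_pos)
        (QE D (GE D (c := (P.L : ℝ) ^ k) (pow_ne_zero _ (Nat.cast_ne_zero.2 P.L_pos.ne')) (w := fun _ => (1 : ℝ)) (fun _ => one_pos)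
          (WithLp.toLp 2 f)))) b)
    {f ℳ : PBond P 0 → Matrix (Fin N) (Fin N) ℂ} {β : ℝ} (hβ : 0 ≤ β) (hf : ∀ b, w 3 b * ‖f b‖ ≤ β)
    (hℳ : ∀ b, ℳ b = ∑ b', Mop (Pi.single b' 1) b • f b')
    {b : PBond P 0} (hb1 : w 1 b = 1) (hb3 : w 3 b = 1) (hbtop : D.InOm k b.src) :
    ‖ℳ b‖ ≤ (B₀ * B₃ + 1) * CQ * CG * β := by
  have hq : 0 ≤ (B₀ * B₃ + 1) * CQ * CG * β := by positivity
  refine norm_le_of_forall_reFunctional (ℳ b) hq fun fd u r hg => ?_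
  have hker : r * (u * fd (ℳ b)).re = Mop (fun i => r * (u * fd (f i)).re) b := reFunctional_kernel Mop hℳ fd u r b
  have hf' : ∀ b', w 3 b' * |(fun i => r * (u * fd (f i)).re) b'| ≤ β :=
    fun b' => (mul_le_mul_of_nonneg_left (hg (f b')) (hw3 b')).trans (hf b')
  have hreal : |Mop (fun i => r * (u * fd (f i)).re) b| ≤ (B₀ * B₃ + 1) * CQ * CG * β :=
    multiplierLetter_real hDk hHf hH h162 hδ₀ hB₀ hd ha hGW hGsup hband hQ hCG hCQ Mop hMop hβ hf' hb1 hb3 hbtop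
  rw [hker]
  exact le_trans (le_abs_self (Mop (fun i => r * (u * fd (f i)).re) b)) hreal

/-- on the top region the (152) level weights are `1` (n07-w4's `levWeightP_eq_one_of_inOm_top`, re-derived here from UST `levOf_inOm_eq_top_iff` to keep the imports light).
[cite: Balaban1985Variational, p.286, (152) p.301] -/
theorem levWeight_eq_one_of_inOm_top {w : ℕ → PBond P 0 → ℝ} (hDk : D.k = k) (hw : IsLevWeight P k D w) {b : PBond P 0} (hb : D.InOm k b.src) (m : ℕ) :
    w m b = 1 := by
  rw [hw m b]
  subst hDk
  have hlev : levOf (fun j => {x : Site P 0 | D.InOm j x}) D.k b.src = D.k := (levOf_inOm_eq_top_iff D b.src).2 hb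
  rw [hlev]
  have hL : (P.L : ℝ) ≠ 0 := Nat.cast_ne_zero.2 P.L_pos.ne'
  rw [inv_pow, mul_inv_cancel₀ (pow_ne_zero _ hL), one_pow]

/-- **THE MULTIPLIER LETTER ON A TOP WINDOW, LEVEL-WEIGHTED SHAPE** (dag-n07-w8's `β₂` slot `ω b·|Q*(QGQ*)⁻¹QG f (b)| ≤ β₂` with `ω := w 3`, k0-s1-w1 g4's `hM`): under the
(152) level weights `IsLevWeight P k D w` (`D.k = k`) and the rows of `multiplierLetter_real`, for every window `Y ⊆ Ω_k^{(k)}`, every current with `w₃|f| ≤ β` and every bond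
with `b₋ ∈ Y`: `w 3 b * |𝔐f(b)| ≤ (B₀B₃ + 1)C_QC_G·β` (the weights are `1` there). [cite: Balaban1985Variational, (133) p.298, (152) p.301, (165) p.304] -/
theorem multiplierLetter_window (hDk : D.k = k) {dBI : PBond P 0 → BondIdx D → ℝ} {w : ℕ → PBond P 0 → ℝ} (hw : IsLevWeight P k D w)
    {H : (BondIdx D → ℝ) →ₗ[ℝ] (PBond P 0 → ℝ)} (hHf : IsFlatH P k D H)
    {δ₀ B₀ B₃ CG CQ : ℝ} (hH : HDecayLetterD P k D dBI w H B₀ δ₀) (h162 : RowSum162 P k D dBI w δ₀ B₃)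
    (hδ₀ : 0 ≤ δ₀) (hB₀ : 0 ≤ B₀) (hd : ∀ b c, 0 ≤ dBI b c)
    {a : BondIdx D → ℝ} (ha : ∀ i, 0 < a i) {G : (PBond P 0 → ℝ) →ₗ[ℝ] (PBond P 0 → ℝ)} (hGW : IsFlatGW P k D ha G)
    (hGsup : GtSupLetterG P k w G CG) (hband : ∀ c : BondIdx D, a c ≤ ((P.L : ℝ) ^ k) ^ (P.d - 1) * (P.L : ℝ) ^ (c.1.1 : ℕ))
    (hQ : QContrLetter P k D w CQ) (hCG : 0 ≤ CG) (hCQ : 0 ≤ CQ)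
    (Mop : (PBond P 0 → ℝ) →ₗ[ℝ] (PBond P 0 → ℝ))
    (hMop : ∀ (f : PBond P 0 → ℝ) (b : PBond P 0),
      Mop f b = QsE D (EE D (c := (P.L : ℝ) ^ k) (pow_ne_zero _ (Nat.cast_ne_zero.2 P.L_pos.ne')) (w := fun _ => (1 : ℝ)) (fun _ => one_pos)
        (QE D (GE D (c := (P.L : ℝ) ^ k) (pow_ne_zero _ (Nat.cast_ne_zero.2 P.L_pos.ne')) (w := fun _ => (1 : ℝ)) (fun _ => one_pos)
          (WithLp.toLp 2 f)))) b)
    {Y : Set (Site P 0)} (hY : ∀ x ∈ Y, D.InOm k x)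
    {f : PBond P 0 → ℝ} {β : ℝ} (hβ : 0 ≤ β) (hf : ∀ b, w 3 b * |f b| ≤ β) (b : PBond P 0) (hb : b.src ∈ Y) :
    w 3 b * |Mop f b| ≤ (B₀ * B₃ + 1) * CQ * CG * β := by
  have hbtop : D.InOm k b.src := hY b.src hb
  have hb1 : w 1 b = 1 := levWeight_eq_one_of_inOm_top hDk hw hbtop 1
  have hb3 : w 3 b = 1 := levWeight_eq_one_of_inOm_top hDk hw hbtop 3
  rw [hb3, one_mul]
  exact multiplierLetter_real hDk hHf hH h162 hδ₀ hB₀ hd ha hGW hGsup hband hQ hCG hCQ Mop hMop hβ hf hb1 hb3 hbtop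

end Generic

/-! ## §3  The `H`-rows read off k0-s1-w3's `BodyAt`, the `Q`-row from `Adm22`; the record edition on NODE 00's four-tori -/

section Record

variable {P : Params} {k : ℕ} {D : Domains P}

/-- `0 ≤ B₀` from the guarded (46) letter at the zero datum. [cite: Balaban1985Variational, (46) p.285 (bookkeeping)] -/
theorem B₀_nonneg_of_hSupLetterG {w : ℕ → PBond P 0 → ℝ} {H : (BondIdx D → ℝ) →ₗ[ℝ] (PBond P 0 → ℝ)} {B₀ : ℝ}
    (h : HSupLetterG P k D w H B₀) : 0 ≤ B₀ := by
  obtain ⟨b₀⟩ : Nonempty (PBond P 0) := ⟨⟨fun _ => 0, ⟨0, P.hd⟩⟩⟩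
  have h1 := (h 0 1 zero_le_one (fun c => by rw [Pi.zero_apply, abs_zero, mul_zero]; exact zero_le_one)).1 b₀
  rwa [map_zero, Pi.zero_apply, abs_zero, mul_zero, mul_one] at h1

/-- **THE MULTIPLIER LETTER WITH THE `H`-ROWS READ OFF `BodyAt`** (k0-s1-w3's P2 body: the canonical `H` pinned by `IsFlatH`, a distance `dBI ≥ distBI ≥ 0` carrying (162) and the
four (161)₁ rows) and the `Q`-row from `qContrLetter_of_adm22` (`Adm22 D R M`, `2L ≤ R·M`, `C_Q = L`): for the (152) level weights, a `G_a` band sup row (displayed) and a matrix current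
`w₃‖f‖ ≤ β`, at every bond of a top window: `‖ℳ(b)‖ ≤ (B₀B₃ + 1)·L·C_G·β`.
[cite: Balaban1985Variational, (131)-(133) p.298, (161)-(163) p.303, (165) p.304; Balaban1984PropagatorsII, (2.1)-(2.2) p.224, Cor. 2.8 (2.150)-(2.151) p.249] -/
theorem multiplierLetter_matrix_of_bodyAt_adm22 [DecidableEq (PBond P 0)] (hDk : D.k = k) {w : ℕ → PBond P 0 → ℝ} (hw : IsLevWeight P k D w)
    {B₀ δ₀ B₃ : ℝ} (hBody : BodyAt P k D w B₀ δ₀ B₃) (hδ₀ : 0 ≤ δ₀) (hB₃ : 0 ≤ B₃)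
    {R M : ℕ} (hAdm : Adm22 D R M) (hRM : 2 * P.L ≤ R * M)
    {a : BondIdx D → ℝ} (ha : ∀ i, 0 < a i) {G : (PBond P 0 → ℝ) →ₗ[ℝ] (PBond P 0 → ℝ)} (hGW : IsFlatGW P k D ha G) {CG : ℝ} (hCG : 0 ≤ CG)
    (hGsup : GtSupLetterG P k w G CG) (hband : ∀ c : BondIdx D, a c ≤ ((P.L : ℝ) ^ k) ^ (P.d - 1) * (P.L : ℝ) ^ (c.1.1 : ℕ))
    (Mop : (PBond P 0 → ℝ) →ₗ[ℝ] (PBond P 0 → ℝ))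
    (hMop : ∀ (f : PBond P 0 → ℝ) (b : PBond P 0),
      Mop f b = QsE D (EE D (c := (P.L : ℝ) ^ k) (pow_ne_zero _ (Nat.cast_ne_zero.2 P.L_pos.ne')) (w := fun _ => (1 : ℝ)) (fun _ => one_pos)
        (QE D (GE D (c := (P.L : ℝ) ^ k) (pow_ne_zero _ (Nat.cast_ne_zero.2 P.L_pos.ne')) (w := fun _ => (1 : ℝ)) (fun _ => one_pos)
          (WithLp.toLp 2 f)))) b)
    {Y : Set (Site P 0)} (hY : ∀ x ∈ Y, D.InOm k x)
    {f ℳ : PBond P 0 → Matrix (Fin N) (Fin N) ℂ} {β : ℝ} (hβ : 0 ≤ β) (hf : ∀ b, w 3 b * ‖f b‖ ≤ β)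
    (hℳ : ∀ b, ℳ b = ∑ b', Mop (Pi.single b' 1) b • f b') (b : PBond P 0) (hb : b.src ∈ Y) :
    ‖ℳ b‖ ≤ (B₀ * B₃ + 1) * (P.L : ℝ) * CG * β := by
  obtain ⟨H, -, hHf, -, hHsup, -, -, dBI, hdist, h162, hHdec⟩ := hBody
  have hB₀ : 0 ≤ B₀ := B₀_nonneg_of_hSupLetterG hHsup
  have hd : ∀ b c, 0 ≤ dBI b c := fun b c => (distBI_nonneg D b c).trans (hdist b c)
  have hQ : QContrLetter P k D w (P.L : ℝ) := qContrLetter_of_adm22 hDk hAdm hRM w hw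
  have hbtop : D.InOm k b.src := hY b.src hb
  exact multiplierLetter_matrix hDk hHf hHdec h162 hδ₀ hB₀ hB₃ hd (fun b' => levWeight_nonneg hw 3 b') ha hGW hGsup hband hQ hCG (Nat.cast_nonneg _) Mop hMop hβ hf hℳ
    (levWeight_eq_one_of_inOm_top hDk hw hbtop 1) (levWeight_eq_one_of_inOm_top hDk hw hbtop 3) hbtop

/-- ★★★ **THE MULTIPLIER LETTER AT EVERY ADMISSIBLE FAMILY OF THE RECORD's TORI** (k0-s1-w3's P9 `body_of_adm22_T4` ∘ §2): for every `F : T4Family` there are thresholds `Mh₀, R₀`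
and constants `B₀`, `δ₀ > 0`, `B₃ > 0` such that for all heights in the standing range (`1 ≤ K − n`, `K − n + 1 ≤ m + K`), every nested family `D` of top level `K − n` on
`Site (F.P K) 0` admissible in the sense [B6] (2.1)–(2.2) (`Adm22 D R (L·M_h)`, `M_h = L^{a′} ≥ Mh₀`, `R ≥ R₀`, `a′ + 3 ≤ m + n`), the (152) level weights `w`, and a `G_a`
band sup row with constant `C_G` (DISPLAYED — the port's own `G`-rows live at the print-natural band weights behind `∃`): for every top window `Y`, every `M_N(ℂ)`-valued current with
`w₃‖f‖ ≤ β` and every bond `b₋ ∈ Y`, the kernel extension of print's `𝔐 = Q*(QGQ*)⁻¹QG` satisfies `‖ℳ(b)‖ ≤ (B₀B₃ + 1)·L·C_G·β` — the `β₂` ∕ `hM` input of the third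
(165) row for `A₁` at the record.  [cite: Balaban1985Variational, (131)-(133) p.298, (152) p.301, (165) p.304; Balaban1984PropagatorsII, (2.1)-(2.2) p.224, Cor. 2.8 (2.150)-(2.151) p.249] -/
theorem exists_multiplierLetter_of_adm22_T4 (F : T4Family) :
    ∃ (Mh₀ R₀ : ℕ) (B₀ δ₀ B₃ : ℝ), 0 < δ₀ ∧ 0 < B₃ ∧
    ∀ (n K : ℕ) (_ : 1 ≤ K - n) (_ : K - n + 1 ≤ F.m + K) {Mh R a' : ℕ} (_ : Mh = F.L ^ a') (_ : Mh₀ ≤ Mh) (_ : R₀ ≤ R)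
      (_ : a' + 3 ≤ F.m + n) (D : Domains (F.P K)) (hDk : D.k = K - n) (_ : Adm22 D R (F.L * Mh)) (_ : 2 * F.L ≤ R * (F.L * Mh))
      (w : ℕ → PBond (F.P K) 0 → ℝ) (_ : IsLevWeight (F.P K) (K - n) D w)
      {instDE : DecidableEq (PBond (F.P K) 0)}
      {a : BondIdx D → ℝ} (ha : ∀ i, 0 < a i) {G : (PBond (F.P K) 0 → ℝ) →ₗ[ℝ] (PBond (F.P K) 0 → ℝ)} (_ : IsFlatGW (F.P K) (K - n) D ha G)
      {CG : ℝ} (_ : 0 ≤ CG) (_ : GtSupLetterG (F.P K) (K - n) w G CG)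
      (_ : ∀ c : BondIdx D, a c ≤ ((F.L : ℝ) ^ (K - n)) ^ (4 - 1) * (F.L : ℝ) ^ (c.1.1 : ℕ))
      (Mop : (PBond (F.P K) 0 → ℝ) →ₗ[ℝ] (PBond (F.P K) 0 → ℝ))
      (_ : ∀ (f : PBond (F.P K) 0 → ℝ) (b : PBond (F.P K) 0),
        Mop f b = QsE D (EE D (c := ((F.P K).L : ℝ) ^ (K - n)) (pow_ne_zero _ (Nat.cast_ne_zero.2 (F.P K).L_pos.ne')) (w := fun _ => (1 : ℝ)) (fun _ => one_pos)
          (QE D (GE D (c := ((F.P K).L : ℝ) ^ (K - n)) (pow_ne_zero _ (Nat.cast_ne_zero.2 (F.P K).L_pos.ne')) (w := fun _ => (1 : ℝ)) (fun _ => one_pos)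
            (WithLp.toLp 2 f)))) b)
      {Y : Set (Site (F.P K) 0)} (_ : ∀ x ∈ Y, D.InOm (K - n) x)
      {f ℳ : PBond (F.P K) 0 → Matrix (Fin N) (Fin N) ℂ} {β : ℝ} (_ : 0 ≤ β) (_ : ∀ b, w 3 b * ‖f b‖ ≤ β)
      (_ : ∀ b, ℳ b = ∑ b', Mop (Pi.single b' 1) b • f b') (b : PBond (F.P K) 0) (_ : b.src ∈ Y),
      ‖ℳ b‖ ≤ (B₀ * B₃ + 1) * (F.L : ℝ) * CG * β := by
  obtain ⟨Mh₀, R₀, B₀, δ₀, B₃, hδ₀, hB₃, hmain⟩ := body_of_adm22_T4 F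
  refine ⟨Mh₀, R₀, B₀, δ₀, B₃, hδ₀, hB₃, ?_⟩
  intro n K hk1 hk' Mh R a' hMha hMh hR hsize D hDk hAdm hRM w hw instDE a ha G hGW CG hCG hGsup hband Mop hMop Y hY f ℳ β hβ hf hℳ b hb
  exact multiplierLetter_matrix_of_bodyAt_adm22 (P := F.P K) hDk hw (hmain n K hk1 hk' hMha hMh hR hsize D hDk hAdm w hw) hδ₀.le hB₃.le hAdm hRM ha hGW hCG hGsup
    hband Mop hMop hY hβ hf hℳ b hb

end Record

end Summit.QuantumFields.YangMills.Theorems.K0Stub1MultiplierLetterP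

end
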